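import Summits.QuantumFields.BalabanUV.T4Continuum.Support.NE3SmoothRightInverseW
import Summits.QuantumFields.BalabanUV.T4Continuum.Support.NE3ResidualSliceRep
import Summits.QuantumFields.BalabanUV.T4Continuum.Support.NE7CornerSpikeTopDictionary
import HarnessLib

/-!
# NE7RightInverseLinear — THE EXACT RIGHT INVERSE `rightInvW` IS LINEAR IN ITS COARSE DATUM (memo ROAD-G100 §3 (ii): «linearity in `φ` (check: `solveW` is a linear solve; if only stated
# per-φ, a 20-line lemma)» — here it is): `rightInvW(φ − ψ) = rightInvW φ − rightInvW ψ`, through `covLift`, the covariant tent corrector and the solved datum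

Cell `pub-balaban`, rung (B)+1 sub-cell t4, lineage `b2b-balaban-t4-ne7-p1`, generation 100 (CRUX PROVER NE7 #1 = OWNER of BINDER row NE7).  Memo `t4/b2b-balaban-t4-ne7-p1-g100/ROAD-G100.md`
§2.2–§2.3 (d): in the supplier (S1) the normal parts of two consecutive iterates differ by `N(u) − N(step u) = rightInvW(φ(u) − φ(step u))`, which is how the right-inverse sup letters
(R5)∕(R6′) of `NE3RightInverseLetters` bound the error field; `NE3SmoothRightInverseW.rightInvW … hφ` is defined per skew datum (the skewness proof is an argument), so its
linearity is a lemma, THIS FILE.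
WHAT ([folklore]; 0 def, 0 sorry; multi-level small-field class at level `k` for the frame part, as in `NE3ResidualSliceRep.framePotW_sub`).
§1 `covLift_sub`, `tinterpW_sub`, `frameGen_sub`, **`hatInvW_sub`** (the lift-plus-corrector `hatInvW` is subtractive in the coarse field).
§2 `resSkew_sub`, **`rightInvW_sub`**: `rightInvW … hφψ y μ = rightInvW … hφ y μ − rightInvW … hψ y μ` for `hφψ : IsSkewDir (φ − ψ)`.
HONEST FRAMING (page 1): linear bookkeeping of OUR objects at one background; nothing of Bałaban's asserted; NOT (L), NOT (S1), NOT NE7; spine 0∕9; finite T⁴ rung (B)+1 — NOT infinite volume,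
NOT mass gap, NOT BetaPertH, NOT Clay.  Continuum YM on T⁴ ⇐ BetaPertH ∧ nine spine estimates (0/9 proved); BetaPertH ⇐ (D1) ∧ (D4) ∧ CAP+tail; G-an2-4 gates asym, D1 and NE2/3/4.
-/

set_option autoImplicit false

open scoped BigOperators Matrix.Norms.L2Operator
open Finset

namespace Summit.QuantumFields.BalabanUV.T4Continuum.NE7RightInverseLinear

open Literature.MathematicalPhysics.QuantumFieldTheory.Balaban1983to89
open B7Prop1Explicit B7Prop2Explicit
open T4AveragingDeficitWall (IsUnitaryCfg IsSkewDir SmallField Ad)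
open T4AveragingDeficitNonAbelian (Ad_sub)
open AveragingDeficitMultiLevelPrep (LevelSmall)
open AveragingDeficitTorusChart (TDir extDir resDir)
open AveragingDeficitTwoLevelPrep (skewSub)
open BlockAveragePushDirGauge (gaugeDir)
open NE3SmoothLiftFlat (smoothLift)
open NE3CovariantLift (covLift hatInvW frameGen)
open NE3CovariantTentInterpolant (tinterpW vtxW)
open SmoothRefineInterp (interp interp_sub)
open NE3SmoothRightInverseW (rightInvW solveW resSkew)
open NE3QbarIterCovLiftPrep (cruxC)
open NE7CornerSpikeTopDictionary (gaugeDir_sub_fun)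
open NE3ResidualSliceRep (framePotW_sub)

noncomputable section

variable {d : ℕ} {n : Type*} [Fintype n] [DecidableEq n]

/-! ## §1 The lift and the corrector are subtractive -/

/-- `covLift` is subtractive in the coarse field. [folklore] -/
theorem covLift_sub (M : ℕ) (W : Site d → Fin d → (Matrix n n ℂ)ˣ) (φ ψ : Site d → Fin d → Matrix n n ℂ) :
    covLift M W (fun y μ => φ y μ - ψ y μ) = fun x κ => covLift M W φ x κ - covLift M W ψ x κ := by
  funext x κ
  simp only [covLift, smoothLift, smul_sub, Ad_sub]

/-- the covariant tent interpolant is subtractive in the vertex data. [folklore] -/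
theorem tinterpW_sub (M : ℕ) (W : Site d → Fin d → (Matrix n n ℂ)ˣ) (m m' : Site d → Matrix n n ℂ) (y : Site d) :
    tinterpW M W (fun w => m w - m' w) y = tinterpW M W m y - tinterpW M W m' y := by
  unfold tinterpW
  rw [← interp_sub]
  congr 1
  funext w
  simp only [vtxW, Ad_sub]

/-- the frame generator of the lift is subtractive (multi-level small-field class at level `k`). [folklore] -/
theorem frameGen_sub [Nonempty n] {L : ℕ} (hL : 1 ≤ L) (k : ℕ) {W : Site d → Fin d → (Matrix n n ℂ)ˣ} {x : ℝ}
    (hWu : IsUnitaryCfg W) (hx : 0 ≤ x) (hs : LevelSmall d L k x) (hWx : SmallField W x) (φ ψ : Site d → Fin d → Matrix n n ℂ) (z : Site d) :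
    frameGen L k W (fun y μ => φ y μ - ψ y μ) z = frameGen L k W φ z - frameGen L k W ψ z := by
  unfold frameGen
  rw [covLift_sub, framePotW_sub hL k hWu hx hs hWx]

/-- **`hatInvW` IS SUBTRACTIVE** in the coarse field (class at level `k`). [folklore] -/
theorem hatInvW_sub [Nonempty n] {L : ℕ} (hL : 1 ≤ L) (k : ℕ) {W : Site d → Fin d → (Matrix n n ℂ)ˣ} {x : ℝ}
    (hWu : IsUnitaryCfg W) (hx : 0 ≤ x) (hs : LevelSmall d L k x) (hWx : SmallField W x) (φ ψ : Site d → Fin d → Matrix n n ℂ) (y : Site d) (μ : Fin d) :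
    hatInvW L k W (fun y μ => φ y μ - ψ y μ) y μ = hatInvW L k W φ y μ - hatInvW L k W ψ y μ := by
  unfold hatInvW
  set G : Site d → Matrix n n ℂ := fun z => -frameGen L k W φ z with hG
  set G' : Site d → Matrix n n ℂ := fun z => -frameGen L k W ψ z with hG'
  have hfg : (fun z => -frameGen L k W (fun y μ => φ y μ - ψ y μ) z) = fun z => G z - G' z := by
    funext z
    simp only [hG, hG', frameGen_sub hL k hWu hx hs hWx, neg_sub_neg]
    exact neg_sub _ _
  have htin : tinterpW (L ^ (k + 1)) W (fun z => G z - G' z) = fun w => tinterpW (L ^ (k + 1)) W G w - tinterpW (L ^ (k + 1)) W G' w :=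
    funext fun w => tinterpW_sub _ _ _ _ w
  rw [covLift_sub, hfg, htin, ← gaugeDir_sub_fun]
  exact (add_sub_add_comm _ _ _ _).symm

/-! ## §2 The right inverse is subtractive -/

omit [Fintype n] [DecidableEq n] in
/-- the torus restriction of a difference. [folklore] -/
theorem resSkew_sub (N : ℕ) {φ ψ : Site d → Fin d → Matrix n n ℂ} (hφ : IsSkewDir φ) (hψ : IsSkewDir ψ) (hφψ : IsSkewDir (fun y μ => φ y μ - ψ y μ)) :
    (resSkew N hφψ : ↥(skewSub d n N)) = resSkew N hφ - resSkew N hψ := by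
  apply Subtype.ext
  funext r κ
  rfl

/-- **THE RIGHT INVERSE IS LINEAR IN THE DATUM**: for skew coarse `φ`, `ψ` (and the skewness witness of `φ − ψ`),
`rightInvW … hφψ y μ = rightInvW … hφ y μ − rightInvW … hψ y μ` — `resSkew`, the linear solve `solveW`, the periodic extension and `hatInvW` are all linear. [folklore] -/
theorem rightInvW_sub [Nonempty n] {L : ℕ} (hL : 2 ≤ L) (k : ℕ) {N : ℕ} [NeZero N] {W : Site d → Fin d → (Matrix n n ℂ)ˣ} {x : ℝ}
    (hWu : IsUnitaryCfg W) (hx : 0 ≤ x) (hs : LevelSmall d L k x) (hWx : SmallField W x)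
    (hθ : cruxC d L * (((L : ℝ) ^ (k + 1)) ^ 2 * x) < 1)
    {φ ψ : Site d → Fin d → Matrix n n ℂ} (hφ : IsSkewDir φ) (hψ : IsSkewDir ψ) (hφψ : IsSkewDir (fun y μ => φ y μ - ψ y μ)) (y : Site d) (μ : Fin d) :
    rightInvW hL k hWu hx hs hWx N hθ hφψ y μ = rightInvW hL k hWu hx hs hWx N hθ hφ y μ - rightInvW hL k hWu hx hs hWx N hθ hψ y μ := by
  unfold rightInvW
  rw [resSkew_sub N hφ hψ hφψ, map_sub]
  have hext : extDir N (((solveW hL k hWu hx hs hWx N hθ (resSkew N hφ) - solveW hL k hWu hx hs hWx N hθ (resSkew N hψ) : ↥(skewSub d n N)) : TDir d n N))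
      = fun z κ => extDir N ((solveW hL k hWu hx hs hWx N hθ (resSkew N hφ) : ↥(skewSub d n N)) : TDir d n N) z κ
          - extDir N ((solveW hL k hWu hx hs hWx N hθ (resSkew N hψ) : ↥(skewSub d n N)) : TDir d n N) z κ := by
    funext z κ
    rfl
  rw [hext, hatInvW_sub (by omega) k hWu hx hs hWx]

end

end Summit.QuantumFields.BalabanUV.T4Continuum.NE7RightInverseLinear
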